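import Literature.AnabelianGeometry.AbsoluteAnabelian.AbsTopIII.KummerTowerPadicSubfieldTorsionProofs
import Mathlib.FieldTheory.KummerPolynomial
import Mathlib.FieldTheory.IntermediateField.Algebraic
import HarnessLib

/-!
# [AbsTopIII] Rmk. 1.5.3 (ii), CM-free witness — degrees and radical descent along an `ℓ`-Kummer
# tower of finite-dimensional subfields of `ℚ̄_p`

Proof-only companion (no new definitions) of `AbsTopIII/KummerFaithful.lean` (abc-iut-L4-t1,
p404026); brick 3a of our witness for the named fact `Rmk_1_5_3_ii` (S. Mochizuki, *Topics in
Absolute Anabelian Geometry III*, §1, Rmk. 1.5.3 (ii), manuscript p. 33).  We work with an abstract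
TOWER `S₀ ≤ S₁ ≤ ⋯` of intermediate fields of `ℚ̄_p / ℚ_p` (`ℚ̄_p = PadicAlgCl p`), each of finite
degree over `ℚ_p`, together with elements `α_n ∈ S_n` such that `α_{n+1}^ℓ = α_n`, `α_0 = p`, and
`S_{n+1} ⊆ ℚ_p(S_n, α_{n+1})` (`ℓ` a prime; in the application `S_n = ℚ_p(α_n, T)` for a finite set
`T`).  Writing `H_r(n₀)` for "every `r`-th root of unity lying in some `S_m` already lies in `S_{n₀}`":

* `exists_layer_of_finset` — finitely many elements of the tower lie in a common layer;
* `step_eq_or_finrank_eq_mul` — under `H_ℓ(n₀)`, for `n ≥ n₀` either `S_{n+1} = S_n` or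
  `[S_{n+1} : ℚ_p] = ℓ · [S_n : ℚ_p]` (`X^ℓ − α_n` is irreducible over `S_n` or has a root there,
  Mathlib `X_pow_sub_C_irreducible_iff_of_prime`);
* `exists_finrank_eq_mul_pow` — hence `[S_{n₀+j} : ℚ_p] = [S_{n₀} : ℚ_p] · ℓ^k` with `k ≤ j`;
* `exists_pow_eq_of_tower_divisible` — **radical descent**: under `H_ℓ(n₀)` and `H_r(n₀)` for a prime
  `r ≠ ℓ`, an element of `S_{n₀}^×` which is an `r^k`-th power in the tower is an `r^k`-th power in
  `S_{n₀}` (an irreducible `X^r − w` would put a factor `r` into the `ℓ`-power `[S_m : S_{n₀}]`);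
* `exists_pow_eq_one_of_forall_exists_pow_prime_pow_eq` — an element of a finite-dimensional
  `S ⊆ ℚ̄_p` with `p^k`-th roots in `S` for every `k` is a root of unity (toolkit: it is a unit, a
  fixed power of it is a principal unit, and `p`-power roots contract principal units to `1`).

HONEST FRAMING: classical Kummer theory / local arithmetic; OUR kernel proofs; nothing here bears on
[IUTchIII] Cor. 3.12. [cite: MochizukiAbsTopIII2015, Rmk 1.5.3 (ii) p.33]
-/

noncomputable section

open scoped Classical

namespace Literature.AnabelianGeometry.AbsoluteAnabelian.AbsTopIII

open Polynomial IntermediateField Literature.NumberTheory.LFunctions Literature.NumberTheory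

variable {p : ℕ} [Fact p.Prime] {S : ℕ → IntermediateField ℚ_[p] (PadicAlgCl p)}

/-! ## §1. Layers -/

/-- A tower `S₀ ≤ S₁ ≤ ⋯` is monotone. [cite: MochizukiAbsTopIII2015, Rmk 1.5.3 (ii) p.33] -/
theorem tower_mono (hS2 : ∀ n, S n ≤ S (n + 1)) {m n : ℕ} (h : m ≤ n) : S m ≤ S n :=
  monotone_nat_of_le_succ hS2 h

/-- Finitely many elements of the tower lie in a common layer.
[cite: MochizukiAbsTopIII2015, Rmk 1.5.3 (ii) p.33] -/
theorem exists_layer_of_finset (hS2 : ∀ n, S n ≤ S (n + 1)) (Z : Finset (PadicAlgCl p))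
    (hZ : ∀ z ∈ Z, ∃ n, z ∈ S n) : ∃ n₀, ∀ z ∈ Z, z ∈ S n₀ := by
  induction Z using Finset.induction_on with
  | empty => exact ⟨0, fun z hz => absurd hz (Finset.notMem_empty z)⟩
  | insert a Z ha ih =>
    obtain ⟨n₁, hn₁⟩ := ih fun z hz => hZ z (Finset.mem_insert_of_mem hz)
    obtain ⟨n₂, hn₂⟩ := hZ a (Finset.mem_insert_self a Z)
    refine ⟨max n₁ n₂, fun z hz => ?_⟩
    rcases Finset.mem_insert.mp hz with rfl | hz
    · exact tower_mono hS2 (le_max_right _ _) hn₂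
    · exact tower_mono hS2 (le_max_left _ _) (hn₁ z hz)

/-- The `N`-th roots of unity of the tower lie in a common layer (there are finitely many `N`-th
roots of unity in `ℚ̄_p`). [cite: MochizukiAbsTopIII2015, Rmk 1.5.3 (ii) p.33] -/
theorem exists_layer_rootsOfUnity (hS2 : ∀ n, S n ≤ S (n + 1)) {N : ℕ} (hN : 0 < N) :
    ∃ n₀, ∀ ζ : PadicAlgCl p, ζ ^ N = 1 → (∃ m, ζ ∈ S m) → ζ ∈ S n₀ := by
  obtain ⟨n₀, hn₀⟩ := exists_layer_of_finset hS2
    (((nthRoots N (1 : PadicAlgCl p)).toFinset).filter fun ζ => ∃ m, ζ ∈ S m)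
    (fun z hz => (Finset.mem_filter.mp hz).2)
  refine ⟨n₀, fun ζ hζ hm => hn₀ ζ ?_⟩
  rw [Finset.mem_filter, Multiset.mem_toFinset, mem_nthRoots hN]
  exact ⟨hζ, hm⟩

/-! ## §2. Degrees along the tower -/

section Degrees

variable {ℓ : ℕ} {α : ℕ → PadicAlgCl p}

/-- `‖p‖ = p⁻¹` in `ℚ̄_p`. [folklore] -/
private theorem norm_natCast_p : ‖(p : PadicAlgCl p)‖ = (p : ℝ)⁻¹ := by
  rw [← map_natCast (algebraMap ℚ_[p] (PadicAlgCl p)) p]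
  exact (PadicAlgCl.norm_extends (p := p) (p : ℚ_[p])).trans Padic.norm_p

/-- `α_n ≠ 0` along the tower (`α_n^{ℓ^n} = p`). [cite: MochizukiAbsTopIII2015, Rmk 1.5.3 (ii) p.33] -/
theorem root_ne_zero (hℓ : ℓ.Prime) (h0 : α 0 = (p : PadicAlgCl p)) (hα : ∀ n, α (n + 1) ^ ℓ = α n)
    (n : ℕ) : α n ≠ 0 := by
  induction n with
  | zero => rw [h0]; exact Nat.cast_ne_zero.mpr (Fact.out : p.Prime).ne_zero
  | succ n ih => intro h; apply ih; rw [← hα n, h, zero_pow hℓ.ne_zero]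

/-- `‖α_n‖^{ℓ^n} = p⁻¹`. [cite: MochizukiAbsTopIII2015, Rmk 1.5.3 (ii) p.33] -/
theorem norm_root_pow (h0 : α 0 = (p : PadicAlgCl p)) (hα : ∀ n, α (n + 1) ^ ℓ = α n) (n : ℕ) :
    ‖α n‖ ^ ℓ ^ n = (p : ℝ)⁻¹ := by
  induction n with
  | zero => rw [pow_zero, pow_one, h0, norm_natCast_p]
  | succ n ih => rw [pow_succ', pow_mul, ← norm_pow, hα n, ih]

/-- **The powers `α_n^i`, `0 ≤ i < ℓ^n`, have pairwise distinct classes in `‖ℚ̄_p^×‖ / p^ℤ`**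
(`‖α_n‖ = p^{-1/ℓ^n}`; the ramification index of `S_n` is at least `ℓ^n`).
[cite: MochizukiAbsTopIII2015, Rmk 1.5.3 (ii) p.33] -/
theorem norm_root_pow_ne (hℓ : ℓ.Prime) (h0 : α 0 = (p : PadicAlgCl p))
    (hα : ∀ n, α (n + 1) ^ ℓ = α n) (n : ℕ) (i j : Fin (ℓ ^ n)) (hij : i ≠ j) (m : ℤ) :
    ‖α n ^ (i : ℕ)‖ ≠ ‖α n ^ (j : ℕ)‖ * (p : ℝ) ^ m := by
  have hp1 : (1 : ℝ) < p := by exact_mod_cast (Fact.out : p.Prime).one_lt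
  have hp0 : (0 : ℝ) < p := by positivity
  have ha0 : 0 < ‖α n‖ := norm_pos_iff.mpr (root_ne_zero hℓ h0 hα n)
  intro h
  rw [norm_pow, norm_pow, ← zpow_natCast, ← zpow_natCast] at h
  have h1 : ‖α n‖ ^ ((i : ℤ) - (j : ℤ)) = (p : ℝ) ^ m := by
    rw [zpow_sub₀ ha0.ne', h, mul_div_cancel_left₀ _ (zpow_ne_zero _ ha0.ne')]
  -- raise to the `ℓ^n`-th power: `p^{-(i-j)} = p^{m ℓ^n}`
  have h2 : ((p : ℝ) ^ m) ^ (ℓ ^ n) = ((p : ℝ)⁻¹) ^ ((i : ℤ) - (j : ℤ)) := by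
    rw [← h1, ← zpow_natCast, ← zpow_mul, mul_comm, zpow_mul, zpow_natCast, norm_root_pow h0 hα n]
  rw [← zpow_natCast, ← zpow_mul, inv_zpow', zpow_neg, ← zpow_neg] at h2
  have h3 : m * ((ℓ ^ n : ℕ) : ℤ) = -((i : ℤ) - (j : ℤ)) := zpow_right_injective₀ hp0 hp1.ne' h2
  have hdvd : ((ℓ ^ n : ℕ) : ℤ) ∣ (i : ℤ) - (j : ℤ) := ⟨-m, by linarith⟩
  have habs : |(i : ℤ) - (j : ℤ)| < ((ℓ ^ n : ℕ) : ℤ) := by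
    have hi := i.isLt
    have hj := j.isLt
    rw [abs_lt]
    constructor <;> omega
  have h4 : (i : ℤ) - (j : ℤ) = 0 := Int.eq_zero_of_abs_lt_dvd hdvd habs
  exact hij (Fin.ext (by omega))

variable [∀ n, FiniteDimensional ℚ_[p] (S n)]

/-- **Degree step**: if every `ℓ`-th root of unity of the tower lies in `S_{n₀}`, then for `n ≥ n₀`
either `S_{n+1} = S_n` (when `X^ℓ − α_n` has a root in `S_n`) or `[S_{n+1} : ℚ_p] = ℓ · [S_n : ℚ_p]`
(when it is irreducible over `S_n`, Mathlib `X_pow_sub_C_irreducible_iff_of_prime`).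
[cite: MochizukiAbsTopIII2015, Rmk 1.5.3 (ii) p.33] -/
theorem step_eq_or_finrank_eq_mul (hℓ : ℓ.Prime) (h0 : α 0 = (p : PadicAlgCl p))
    (hα : ∀ n, α (n + 1) ^ ℓ = α n) (hS1 : ∀ n, α n ∈ S n) (hS2 : ∀ n, S n ≤ S (n + 1))
    (hS3 : ∀ n, S (n + 1) ≤ adjoin ℚ_[p] ((S n : Set (PadicAlgCl p)) ∪ {α (n + 1)}))
    {n₀ : ℕ} (Hℓ : ∀ ζ : PadicAlgCl p, ζ ^ ℓ = 1 → (∃ m, ζ ∈ S m) → ζ ∈ S n₀) {n : ℕ}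
    (hn : n₀ ≤ n) :
    S (n + 1) = S n ∨
      Module.finrank ℚ_[p] (S (n + 1)) = Module.finrank ℚ_[p] (S n) * ℓ := by
  set F := S n with hF
  set a := α (n + 1) with ha
  by_cases hc : ∃ c ∈ F, c ^ ℓ = α n
  · -- `X^ℓ − α_n` has a root `c ∈ S_n`: then `a = ζ c` with `ζ^ℓ = 1`, `ζ ∈ S_{n₀}`
    left
    obtain ⟨c, hcF, hc⟩ := hc
    have hc0 : c ≠ 0 := by
      rintro rfl
      rw [zero_pow hℓ.ne_zero] at hc
      exact root_ne_zero hℓ h0 hα n hc.symm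
    have hζ : (a / c) ^ ℓ = 1 := by rw [div_pow, ha, hα n, hc, div_self (root_ne_zero hℓ h0 hα n)]
    have hζmem : a / c ∈ S n₀ :=
      Hℓ _ hζ ⟨n + 1, div_mem (hS1 (n + 1)) (hS2 n hcF)⟩
    have haF : a ∈ F := by
      have : a = a / c * c := by rw [div_mul_cancel₀ a hc0]
      rw [this]
      exact mul_mem (tower_mono hS2 hn hζmem) hcF
    refine le_antisymm ((hS3 n).trans (adjoin_le_iff.mpr ?_)) (hS2 n)
    rintro x (hx | hx)
    · exact hx
    · rw [Set.mem_singleton_iff] at hx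
      rw [hx]
      exact haF
  · -- `X^ℓ − α_n` is irreducible over `S_n`: `[S_n(a) : S_n] = ℓ`
    right
    push Not at hc
    set b : F := ⟨α n, hS1 n⟩ with hb
    have hirr : Irreducible (X ^ ℓ - C b) := by
      refine (X_pow_sub_C_irreducible_iff_of_prime hℓ).mpr fun c hcb => ?_
      exact hc c c.2 (by
        change ((c : PadicAlgCl p)) ^ ℓ = ((b : F) : PadicAlgCl p)
        rw [← SubmonoidClass.coe_pow, hcb])
    have hint : IsIntegral F a := (Algebra.IsIntegral.isIntegral (R := ℚ_[p]) a).tower_top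
    have hmin : minpoly F a = X ^ ℓ - C b := by
      refine (minpoly.eq_of_irreducible_of_monic hirr ?_ (monic_X_pow_sub_C b hℓ.ne_zero)).symm
      simp only [map_sub, map_pow, aeval_X, aeval_C]
      rw [sub_eq_zero, ha, hα n]
      rfl
    have hdeg : Module.finrank F F⟮a⟯ = ℓ := by
      rw [adjoin.finrank hint, hmin, natDegree_X_pow_sub_C]
    -- `S_{n+1}`, as an extension of `F = S_n`, is `F(a)`
    have h : F ≤ S (n + 1) := hS2 n
    have hext : extendScalars h = F⟮a⟯ := by
      refine le_antisymm (fun x hx => ?_) (adjoin_simple_le_iff.mpr (hS1 (n + 1)))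
      rw [mem_extendScalars] at hx
      have hx' := hS3 n hx
      rw [← restrictScalars_adjoin] at hx'
      exact hx'
    have htower : Module.finrank ℚ_[p] F * Module.finrank F (extendScalars h) =
        Module.finrank ℚ_[p] (S (n + 1)) := by
      rw [Module.finrank_mul_finrank]
      rfl
    rw [← htower, hext, hdeg]

/-- **Degrees along the tower are `ℓ`-powers**: under the hypothesis of `step_eq_or_finrank_eq_mul`,
`[S_{n₀+j} : ℚ_p] = [S_{n₀} : ℚ_p] · ℓ^k` for some `k ≤ j`.
[cite: MochizukiAbsTopIII2015, Rmk 1.5.3 (ii) p.33] -/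
theorem exists_finrank_eq_mul_pow (hℓ : ℓ.Prime) (h0 : α 0 = (p : PadicAlgCl p))
    (hα : ∀ n, α (n + 1) ^ ℓ = α n) (hS1 : ∀ n, α n ∈ S n) (hS2 : ∀ n, S n ≤ S (n + 1))
    (hS3 : ∀ n, S (n + 1) ≤ adjoin ℚ_[p] ((S n : Set (PadicAlgCl p)) ∪ {α (n + 1)}))
    {n₀ : ℕ} (Hℓ : ∀ ζ : PadicAlgCl p, ζ ^ ℓ = 1 → (∃ m, ζ ∈ S m) → ζ ∈ S n₀) (j : ℕ) :
    ∃ k, k ≤ j ∧ Module.finrank ℚ_[p] (S (n₀ + j)) = Module.finrank ℚ_[p] (S n₀) * ℓ ^ k := by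
  induction j with
  | zero => exact ⟨0, le_rfl, by simp⟩
  | succ j ih =>
    obtain ⟨k, hk, hfin⟩ := ih
    rcases step_eq_or_finrank_eq_mul hℓ h0 hα hS1 hS2 hS3 Hℓ (n := n₀ + j) (Nat.le_add_right _ _)
      with heq | hmul
    · refine ⟨k, hk.trans (Nat.le_succ j), ?_⟩
      rw [← add_assoc, heq, hfin]
    · refine ⟨k + 1, Nat.succ_le_succ hk, ?_⟩
      rw [← add_assoc, hmul, hfin, pow_succ, mul_assoc]

/-- For `n ≥ n₀`: `[S_n : ℚ_p] = [S_{n₀} : ℚ_p] · ℓ^k` with `k ≤ n`.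
[cite: MochizukiAbsTopIII2015, Rmk 1.5.3 (ii) p.33] -/
theorem exists_finrank_eq_mul_pow' (hℓ : ℓ.Prime) (h0 : α 0 = (p : PadicAlgCl p))
    (hα : ∀ n, α (n + 1) ^ ℓ = α n) (hS1 : ∀ n, α n ∈ S n) (hS2 : ∀ n, S n ≤ S (n + 1))
    (hS3 : ∀ n, S (n + 1) ≤ adjoin ℚ_[p] ((S n : Set (PadicAlgCl p)) ∪ {α (n + 1)}))
    {n₀ : ℕ} (Hℓ : ∀ ζ : PadicAlgCl p, ζ ^ ℓ = 1 → (∃ m, ζ ∈ S m) → ζ ∈ S n₀) {n : ℕ}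
    (hn : n₀ ≤ n) :
    ∃ k, k ≤ n ∧ Module.finrank ℚ_[p] (S n) = Module.finrank ℚ_[p] (S n₀) * ℓ ^ k := by
  obtain ⟨k, hk, h⟩ := exists_finrank_eq_mul_pow hℓ h0 hα hS1 hS2 hS3 Hℓ (n - n₀)
  refine ⟨k, hk.trans (Nat.sub_le n n₀), ?_⟩
  rwa [Nat.add_sub_cancel' hn] at h

/-! ## §3. Radical descent -/

/-- **Radical descent along the tower**: let `r ≠ ℓ` be a prime such that the `ℓ`-th and the
`r`-th roots of unity of the tower lie in `S_{n₀}`.  If `w ∈ S_{n₀}^×` has an `r^k`-th root somewhere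
in the tower, it has one in `S_{n₀}`: otherwise at the first failing step `X^r − w'` is irreducible
over `S_{n₀}` and its root generates a degree-`r` subextension of some `S_m`, whose degree over
`S_{n₀}` is a power of `ℓ`. [cite: MochizukiAbsTopIII2015, Rmk 1.5.3 (ii) p.33] -/
theorem exists_pow_eq_of_tower_divisible (hℓ : ℓ.Prime) (h0 : α 0 = (p : PadicAlgCl p))
    (hα : ∀ n, α (n + 1) ^ ℓ = α n) (hS1 : ∀ n, α n ∈ S n) (hS2 : ∀ n, S n ≤ S (n + 1))
    (hS3 : ∀ n, S (n + 1) ≤ adjoin ℚ_[p] ((S n : Set (PadicAlgCl p)) ∪ {α (n + 1)}))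
    {r : ℕ} (hr : r.Prime) (hrℓ : r ≠ ℓ) {n₀ : ℕ}
    (Hℓ : ∀ ζ : PadicAlgCl p, ζ ^ ℓ = 1 → (∃ m, ζ ∈ S m) → ζ ∈ S n₀)
    (Hr : ∀ ζ : PadicAlgCl p, ζ ^ r = 1 → (∃ m, ζ ∈ S m) → ζ ∈ S n₀) :
    ∀ (k : ℕ) (w : PadicAlgCl p), w ∈ S n₀ → w ≠ 0 → (∃ m, ∃ y ∈ S m, y ^ r ^ k = w) →
      ∃ z ∈ S n₀, z ^ r ^ k = w := by
  intro k
  induction k with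
  | zero =>
    intro w hw _ _
    exact ⟨w, hw, by rw [pow_zero, pow_one]⟩
  | succ k ih =>
    intro w hw hw0 ⟨m, y, hy, hyw⟩
    set F := S n₀ with hF
    -- `u = y^{r^k}` is an `r`-th root of `w` in the layer `S_{m'}`, `m' = max m n₀`
    set u := y ^ r ^ k with hu
    have hur : u ^ r = w := by rw [hu, ← pow_mul, ← pow_succ, hyw]
    set m' := max m n₀ with hm'
    have hum' : u ∈ S m' := pow_mem (tower_mono hS2 (le_max_left m n₀) hy) _
    have hFle : F ≤ S m' := tower_mono hS2 (le_max_right m n₀)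
    -- `u ∈ S_{n₀}`
    have huF : u ∈ F := by
      by_cases hc : ∃ c ∈ F, c ^ r = w
      · obtain ⟨c, hcF, hc⟩ := hc
        have hc0 : c ≠ 0 := by
          rintro rfl
          rw [zero_pow hr.ne_zero] at hc
          exact hw0 hc.symm
        have hζ : (u / c) ^ r = 1 := by rw [div_pow, hur, hc, div_self hw0]
        have hζF : u / c ∈ F := Hr _ hζ ⟨m', div_mem hum' (hFle hcF)⟩
        have : u = u / c * c := by rw [div_mul_cancel₀ u hc0]
        rw [this]
        exact mul_mem hζF hcF
      · -- impossible: `X^r − w` irreducible over `F` gives `r ∣ [S_{m'} : F] = ℓ^k'`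
        exfalso
        push Not at hc
        set w' : F := ⟨w, hw⟩ with hw'
        have hirr : Irreducible (X ^ r - C w') := by
          refine (X_pow_sub_C_irreducible_iff_of_prime hr).mpr fun c hcw => ?_
          exact hc c c.2 (by
            change ((c : PadicAlgCl p)) ^ r = ((w' : F) : PadicAlgCl p)
            rw [← SubmonoidClass.coe_pow, hcw])
        have hint : IsIntegral F u := (Algebra.IsIntegral.isIntegral (R := ℚ_[p]) u).tower_top
        have hmin : minpoly F u = X ^ r - C w' := by
          refine (minpoly.eq_of_irreducible_of_monic hirr ?_ (monic_X_pow_sub_C w' hr.ne_zero)).symm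
          simp only [map_sub, map_pow, aeval_X, aeval_C]
          rw [sub_eq_zero, hur]
          rfl
        have hdeg : Module.finrank F F⟮u⟯ = r := by
          rw [adjoin.finrank hint, hmin, natDegree_X_pow_sub_C]
        have hle : F⟮u⟯ ≤ extendScalars hFle := adjoin_simple_le_iff.mpr hum'
        have hdvd : r ∣ Module.finrank F (extendScalars hFle) := by
          rw [← hdeg]
          exact finrank_dvd_of_le_right hle
        obtain ⟨k', -, hk'⟩ := exists_finrank_eq_mul_pow' hℓ h0 hα hS1 hS2 hS3 Hℓ
          (n := m') (le_max_right m n₀)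
        have htower : Module.finrank ℚ_[p] F * Module.finrank F (extendScalars hFle) =
            Module.finrank ℚ_[p] (S m') := by
          rw [Module.finrank_mul_finrank]
          rfl
        rw [hk'] at htower
        have hpos : 0 < Module.finrank ℚ_[p] F := Module.finrank_pos
        have heq : Module.finrank F (extendScalars hFle) = ℓ ^ k' :=
          Nat.eq_of_mul_eq_mul_left hpos htower
        rw [heq] at hdvd
        exact hrℓ ((Nat.prime_dvd_prime_iff_eq hr hℓ).mp (hr.dvd_of_dvd_pow hdvd))
    -- descend `u` by induction, then `z^{r^{k+1}} = (z^{r^k})^r = u^r = w`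
    have hu0 : u ≠ 0 := by
      intro h
      rw [h, zero_pow hr.ne_zero] at hur
      exact hw0 hur.symm
    obtain ⟨z, hzF, hz⟩ := ih u huF hu0 ⟨m, y, hy, rfl⟩
    exact ⟨z, hzF, by rw [pow_succ, pow_mul, hz, hur]⟩

end Degrees

/-! ## §4. From `p`-power divisibility to torsion in a finite-dimensional subfield -/

/-- **An element of `S^×` (finite-dimensional `S`) with `p^k`-th roots in `S` for all `k` is a root of
unity**: it is a unit (`norm_eq_one_of_forall_exists_pow_eq`), a fixed power `x^M` of it is a
principal unit together with the `M`-th powers of its roots (`exists_pow_norm_sub_one_lt`), and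
`x^M = (z_k^M)^{p^k}` is then arbitrarily close to `1` (`norm_pow_prime_pow_sub_one_le`).
[cite: MochizukiAbsTopIII2015, Rmk 1.5.3 (ii) p.33] -/
theorem exists_pow_eq_one_of_forall_exists_pow_prime_pow_eq (F : IntermediateField ℚ_[p] (PadicAlgCl p))
    [FiniteDimensional ℚ_[p] F] {x : PadicAlgCl p} (hx : x ∈ F) (hx0 : x ≠ 0)
    (h : ∀ k : ℕ, ∃ z ∈ F, z ^ p ^ k = x) : ∃ M : ℕ, 0 < M ∧ x ^ M = 1 := by
  have hp1 : (1 : ℝ) < p := by exact_mod_cast (Fact.out : p.Prime).one_lt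
  have hp0 : (0 : ℝ) < p := by positivity
  obtain ⟨d, hd, hdisc⟩ := exists_norm_pow_eq_zpow p F
  obtain ⟨M, hM, hMU⟩ := exists_pow_norm_sub_one_lt p F
  refine ⟨M, hM, ?_⟩
  have hx1 : ‖x‖ = 1 := norm_eq_one_of_forall_exists_pow_eq hd hdisc hx hx0 h
  -- uniform bound `ρ₀ < 1` on principal units of `F`
  set ρ₀ : ℝ := ((p : ℝ)⁻¹) ^ ((d : ℝ)⁻¹) with hρ₀
  have hρ₀pos : 0 < ρ₀ := Real.rpow_pos_of_pos (inv_pos.mpr hp0) _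
  have hρ₀lt : ρ₀ < 1 :=
    Real.rpow_lt_one (inv_pos.mpr hp0).le (inv_lt_one_of_one_lt₀ hp1) (by positivity)
  have hunif : ∀ u ∈ F, ‖u - 1‖ < 1 → ‖u - 1‖ ≤ ρ₀ := by
    intro u hu hlt
    have h1 : ‖u - 1‖ ^ d ≤ (p : ℝ)⁻¹ :=
      norm_pow_le_inv_of_norm_lt_one hd hdisc (sub_mem hu (one_mem F)) hlt
    have h2 : (‖u - 1‖ ^ d) ^ ((d : ℝ)⁻¹) ≤ ((p : ℝ)⁻¹) ^ ((d : ℝ)⁻¹) :=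
      Real.rpow_le_rpow (by positivity) h1 (by positivity)
    rwa [Real.pow_rpow_inv_natCast (norm_nonneg _) hd.ne'] at h2
  set c : ℝ := max ‖(p : PadicAlgCl p)‖ ρ₀ with hc
  have hc0 : 0 < c := lt_max_of_lt_right hρ₀pos
  have hc1 : c < 1 := by
    refine max_lt ?_ hρ₀lt
    rw [← map_natCast (algebraMap ℚ_[p] (PadicAlgCl p)) p]
    rw [show ‖(algebraMap ℚ_[p] (PadicAlgCl p)) (p : ℚ_[p])‖ = ‖(p : ℚ_[p])‖ from
      PadicAlgCl.norm_extends (p := p) (p : ℚ_[p]), Padic.norm_p]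
    exact inv_lt_one_of_one_lt₀ hp1
  -- `‖x^M − 1‖ ≤ ρ₀ c^k` for every `k`
  have hbound : ∀ k, ‖x ^ M - 1‖ ≤ ρ₀ * c ^ k := by
    intro k
    obtain ⟨z, hzF, hz⟩ := h k
    have hz0 : z ≠ 0 := by
      rintro rfl
      rw [zero_pow (pow_ne_zero k (Fact.out : p.Prime).ne_zero)] at hz
      exact hx0 hz.symm
    have hz1 : ‖z‖ = 1 := by
      have : ‖z‖ ^ p ^ k = 1 := by rw [← norm_pow, hz, hx1]
      exact (pow_eq_one_iff_of_nonneg (norm_nonneg z) (pow_ne_zero k (Fact.out : p.Prime).ne_zero)).mp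
        this
    have hzM : ‖z ^ M - 1‖ ≤ ρ₀ := hunif _ (pow_mem hzF M) (hMU z hzF hz1)
    have hrew : x ^ M = (z ^ M) ^ p ^ k := by rw [← hz, ← pow_mul, ← pow_mul, mul_comm]
    rw [hrew]
    exact norm_pow_prime_pow_sub_one_le hρ₀pos.le hρ₀lt.le hzM k
  -- hence `x^M = 1`
  by_contra hne
  have hpos : 0 < ‖x ^ M - 1‖ := norm_pos_iff.mpr (sub_ne_zero.mpr hne)
  obtain ⟨k, hk⟩ := exists_pow_lt_of_lt_one (div_pos hpos hρ₀pos) hc1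
  have := hbound k
  rw [lt_div_iff₀ hρ₀pos, mul_comm] at hk
  linarith

end Literature.AnabelianGeometry.AbsoluteAnabelian.AbsTopIII

end
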